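import Summits.ResolutionOfSingularities.ResolutionOfSingularities.Theorems.WeightedInvariantLexMaxCentreGlobalChart
import HarnessLib

/-!
# F-AQS-T in the kernel, (o25-γ) GLOBALISATION: a weighted chart for the centre contracted from a weighted germ
# filtration at a point with regular local ring

Route `ResolutionOfSingularities/WeightedInvariant`, door crux `HypersurfaceCentreConstruction`
(stmt-ResolutionOfSingularities-19897) — OURS, helper; ORDER (o25) «F-AQS-T in the kernel» of `res-L1-w43-plan-1`
(2026-08-27T09:19Z; target `AbramovichQuekSchober2025_heightTwoCentre_holds`, the named fact of
`Literature/AlgebraicGeometry/Resolution/HypersurfaceHeightTwoWeightedCentre.lean` l.176–195; team: lead/design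
res-type-092, (α) local lex-max res-type-092 + res-type-070, (β) order drop res-type-098, **(γ) globalisation
res-type-047** — DEALS gen 9 #22).  This file is (γ): the GLOBAL OBJECTS of the fact's conclusion — an affine open
`U ∋ η` with sections `u` lifting the germ parameters `x` EXACTLY, such that the Rees algebra contracted from the
weighted germ filtration `(x^α : w·α ≥ n)` (`ReesAlgebraData.ofGermFiltration`, res-D-pv-025 p507610) is a weighted
chart `(U, u, w)` and is supported on `closure {η}` (Abramovich–Quek–Schober §4: «This local construction becomes
global via `𝓘ₙ = 𝒪_S` away from `q`» [cite: AbramovichQuekSchober2025, §4 p. 9 L3 of arXiv:2507.01232v1]).  No torus,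
no density, any field; the lex-max clause and `ℓ / w₀ = ord` ride along from (α)'s local data, the order drop on
`B₊(U)` is (β).

* preliminaries (§1 spreading out, §2 lifting germs, §3 the reduced `closure {η}` on a chart) are in
  `…Theorems/WeightedInvariantLexMaxCentreGlobalChart.lean`;
* §4 **`exists_isWeightedChart_ofGermFiltration`** — for `Y → Spec k` locally of finite type, `η` with regular local
  ring of dimension `m`, generators `x` of `𝔪_η`, positive weights `w`: `∃ U ∋ η, u` with `germ_η uᵢ = xᵢ` and
  `(ofGermFiltration η (x^α : w·α ≥ ·)).IsWeightedChart U u w`; route: sections on an affine `W` inside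
  `Reg(Y) ∩ (Y ∖ Sing(closure {η}))` (both open: excellence of schemes locally of finite type over a field,
  `isOpen_regularLocus_of_locallyOfFiniteType_field`), shrink to `D(s)` by §1, and at a common zero `y` of `u`:
  `(u)𝒪_y = 𝔭_η𝒪_y` is a prime of height `m` (`height_primeIdealOf_eq`, res-D-pv-025 p515163) with regular quotient
  (§3), so no `uᵢ` is redundant by Krull's height theorem and `u` is part of a regular system of parameters at `y`
  (Matsumura 14.2, Literature `linearIndependent_toCotangent_of_isRegularLocalRing_quotient`); the common zeros lie
  in `closure {η}`; conclude by res-D-pv-025's `isWeightedChart_ofGermFiltration` (p510567);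
  `exists_isWeightedChart_and_support_ofGermFiltration` adds `support = closure {η}` (p510567) in the fact's shape.

No definitions.  Nothing here is a claim about Hironaka's problem or about any manuscript under adjudication;
AI-written, weaker than expert review.
-/

noncomputable section

set_option linter.dupNamespace false -- mandated namespace of this single-conjunct summit

namespace Summit.ResolutionOfSingularities.ResolutionOfSingularities.Theorems.LexMaxCentreGlobal

universe u

open CategoryTheory AlgebraicGeometry TopologicalSpace IsLocalRing Opposite
open Literature.AlgebraicGeometry.Resolution Scheme.IdealSheafData

/-! ## §4 Globalisation: a weighted chart for the contracted centre on a neighbourhood of `η` -/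

section Main

/-- **(o25-γ) GLOBALISATION — a weighted chart for the centre contracted from a weighted germ filtration.**  Let
`Y → Spec k` be locally of finite type, `η ∈ Y` a point with regular local ring of dimension `m`, `x = (x₁, …, x_m)`
generators of `𝔪_η` (a regular system of parameters) and `w` positive weights.  Then some affine open `U ∋ η`
carries sections `u` with germs EXACTLY `x` at `η` such that the Rees algebra
`ofGermFiltration η (x^α : w·α ≥ ·)` (res-D-pv-025, p507610) is a weighted chart `(U, u, w)`
(`ReesAlgebraData.IsWeightedChart`: pieces `= weightedMonomialIdeal u w n` on `U`, and `u` part of a regular system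
of parameters at every point of `U` where it vanishes).  Construction: lift the germs to sections `g` on an affine
`W ∋ η` inside the open set where `Y` is regular and the reduced closed subscheme `closure {η}` is regular; shrink to
a basic open `U = D(s)` on which `(g)` and `𝔭_η` agree at every local ring (§1); at a common zero `y ∈ U` of `u`:
`(u)𝒪_y = 𝔭_η 𝒪_y` is a prime of height `m` with regular quotient, so by Krull's height theorem no `uᵢ` is
redundant and `u` is part of a regular system of parameters at `y` (Matsumura 14.2,
`linearIndependent_toCotangent_of_isRegularLocalRing_quotient`); conclude by stub-10's `isWeightedChart_ofGermFiltration`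
(p510567).  This is the global half of Abramovich–Quek–Schober's Thm 1.3 (1) data («This local construction becomes
global via `𝓘ₙ = 𝒪_S` away from `q`», §4) with NO torus and NO density argument. [cite: AbramovichQuekSchober2025, §4 (p. 9 L3 of arXiv v1)] -/
theorem exists_isWeightedChart_ofGermFiltration {k : Type u} [Field k] {Y : Scheme.{u}}
    (f : Y ⟶ Spec (.of k)) [LocallyOfFiniteType f] (η : Y) [IsRegularLocalRing (Y.presheaf.stalk η)] {m : ℕ}
    (hdim : ringKrullDim (Y.presheaf.stalk η) = (m : WithBot ℕ∞))
    (x : Fin m → Y.presheaf.stalk η) (hx : Ideal.span (Set.range x) = maximalIdeal (Y.presheaf.stalk η))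
    (w : Fin m → ℕ) (hw : ∀ i, 0 < w i)
    (h0 : weightedMonomialIdeal x w 0 = ⊤)
    (hmul : ∀ a b, weightedMonomialIdeal x w a * weightedMonomialIdeal x w b ≤
      weightedMonomialIdeal x w (a + b))
    (hprim : ∀ n, ∃ N : ℕ, maximalIdeal (Y.presheaf.stalk η) ^ N ≤ weightedMonomialIdeal x w n) :
    ∃ (U : Y.affineOpens) (hηU : η ∈ (U : Y.Opens)) (u : Fin m → Γ(Y, U)),
      (∀ i, (Y.presheaf.germ (U : Y.Opens) η hηU).hom (u i) = x i) ∧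
      (ReesAlgebraData.ofGermFiltration η (fun n => weightedMonomialIdeal x w n) h0 hmul hprim).IsWeightedChart
        U u w := by
  classical
  haveI : IsLocallyNoetherian Y := LocallyOfFiniteType.isLocallyNoetherian f
  -- the reduced closed subscheme `Z = closure {η}` and the open set `Ω` where `Y` and `Z` are regular
  let Z : Closeds Y := ⟨closure ({η} : Set Y), isClosed_closure⟩
  let ι := (vanishingIdeal Z).subschemeι
  have hRegY : IsOpen (Scheme.regularLocus Y) := isOpen_regularLocus_of_locallyOfFiniteType_field f
  have hRegZ : IsOpen (Scheme.regularLocus (vanishingIdeal Z).subscheme) :=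
    isOpen_regularLocus_of_locallyOfFiniteType_field (ι ≫ f)
  let B : Set Y := ι.base '' (Scheme.regularLocus (vanishingIdeal Z).subscheme)ᶜ
  have hB : IsClosed B := ι.isClosedEmbedding.isClosedMap _ hRegZ.isClosed_compl
  let Ω : Y.Opens := ⟨Scheme.regularLocus Y ∩ Bᶜ, hRegY.inter hB.isOpen_compl⟩
  -- `η ∈ Ω`
  obtain ⟨W₀, hW₀, hηW₀, -⟩ :=
    exists_isAffineOpen_mem_and_subset (X := Y) (x := η) (U := ⊤) (Opens.mem_top η)
  have hηΩ : η ∈ Ω := by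
    refine ⟨‹IsRegularLocalRing (Y.presheaf.stalk η)›, ?_⟩
    rintro ⟨y', hy', hy'η⟩
    apply hy'
    change IsRegularLocalRing _
    rw [isRegularLocalRing_stalk_subscheme_iff, hy'η,
      stalkIdeal_vanishingIdeal_closure_eq ⟨W₀, hW₀⟩ hηW₀ hηW₀]
    exact isRegularLocalRing_quotient_map_primeIdealOf_self ⟨W₀, hW₀⟩ hηW₀
  -- sections lifting the germs on an affine `W ⊆ Ω`
  obtain ⟨W, hηW, hWΩ, g, hg⟩ := exists_affineOpens_forall_germ_eq Ω hηΩ x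
  letI algη : Algebra Γ(Y, W) (Y.presheaf.stalk η) := TopCat.Presheaf.algebra_section_stalk Y.presheaf ⟨η, hηW⟩
  haveI := W.2.isLocalization_stalk ⟨η, hηW⟩
  haveI : IsNoetherianRing Γ(Y, W) := IsLocallyNoetherian.component_noetherian W
  have hgerm : (Y.presheaf.germ (W : Y.Opens) η hηW).hom = algebraMap Γ(Y, W) (Y.presheaf.stalk η) := rfl
  -- `(g)` and `𝔭_η` agree at `η`
  have hxm : ∀ i, x i ∈ maximalIdeal (Y.presheaf.stalk η) := fun i =>
    hx ▸ Ideal.subset_span (Set.mem_range_self i)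
  have hgP : Ideal.span (Set.range g) ≤ (W.2.primeIdealOf ⟨η, hηW⟩).asIdeal := by
    refine Ideal.span_le.mpr (Set.range_subset_iff.mpr fun i => ?_)
    rw [SetLike.mem_coe, ← germ_mem_maximalIdeal_iff_mem_primeIdealOf W hηW (g i), hg i]
    exact hxm i
  have hpx : ((W.2.primeIdealOf ⟨η, hηW⟩).asIdeal).map (algebraMap Γ(Y, W) (Y.presheaf.stalk η)) ≤
      (Ideal.span (Set.range g)).map (algebraMap Γ(Y, W) (Y.presheaf.stalk η)) := by
    rw [← IsLocalization.AtPrime.under_maximalIdeal (Y.presheaf.stalk η) (W.2.primeIdealOf ⟨η, hηW⟩).asIdeal,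
      Ideal.under_def, IsLocalization.map_under (W.2.primeIdealOf ⟨η, hηW⟩).asIdeal.primeCompl
        (S := Y.presheaf.stalk η), Ideal.map_span, ← Set.range_comp, ← hx]
    have hcomp : ((algebraMap Γ(Y, W) (Y.presheaf.stalk η)) ∘ g) = x := funext fun i => hg i
    rw [hcomp]
  obtain ⟨s, hs, hloc⟩ := exists_not_mem_forall_map_eq (Ideal.span (Set.range g))
    (W.2.primeIdealOf ⟨η, hηW⟩).asIdeal hgP (Y.presheaf.stalk η) hpx
  -- the chart `U = D(s)` and the restricted sections
  let U : Y.affineOpens := Y.affineBasicOpen s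
  have hUW : (U : Y.Opens) ≤ W := Y.basicOpen_le s
  have hηU : η ∈ (U : Y.Opens) := by
    change η ∈ Y.basicOpen s
    rw [Y.mem_basicOpen s η hηW]
    have : s ∉ (W.2.primeIdealOf ⟨η, hηW⟩).asIdeal := hs
    rw [← germ_mem_maximalIdeal_iff_mem_primeIdealOf W hηW s, mem_maximalIdeal, mem_nonunits_iff, not_not] at this
    exact this
  let u : Fin m → Γ(Y, U) := fun i => (Y.presheaf.map (homOfLE hUW).op).hom (g i)
  have hres : ∀ (y : Y) (hyU : y ∈ (U : Y.Opens)) (i : Fin m),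
      (Y.presheaf.germ (U : Y.Opens) y hyU).hom (u i) = (Y.presheaf.germ (W : Y.Opens) y (hUW hyU)).hom (g i) :=
    fun y hyU i => TopCat.Presheaf.germ_res_apply Y.presheaf (homOfLE hUW) y hyU (g i)
  have hu : ∀ i, (Y.presheaf.germ (U : Y.Opens) η hηU).hom (u i) = x i := fun i => by rw [hres, hg]
  -- replace `x` by the germs of `u`
  obtain rfl : x = fun i => (Y.presheaf.germ (U : Y.Opens) η hηU).hom (u i) := (funext hu).symm
  -- at a point `y ∈ U`: the local ring is a localization of `Γ(Y, W)` off `s`, so `(g)𝒪_y = 𝔭_η 𝒪_y`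
  have key : ∀ (y : Y) (hyU : y ∈ (U : Y.Opens)),
      Ideal.span (Set.range fun i => (Y.presheaf.germ (U : Y.Opens) y hyU).hom (u i)) =
        ((W.2.primeIdealOf ⟨η, hηW⟩).asIdeal).map (Y.presheaf.germ (W : Y.Opens) y (hUW hyU)).hom := by
    intro y hyU
    letI algy : Algebra Γ(Y, W) (Y.presheaf.stalk y) :=
      TopCat.Presheaf.algebra_section_stalk Y.presheaf ⟨y, hUW hyU⟩
    haveI := W.2.isLocalization_stalk ⟨y, hUW hyU⟩
    have hsy : s ∉ (W.2.primeIdealOf ⟨y, hUW hyU⟩).asIdeal := by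
      rw [← germ_mem_maximalIdeal_iff_mem_primeIdealOf W (hUW hyU) s, mem_maximalIdeal, mem_nonunits_iff,
        not_not]
      exact (Y.mem_basicOpen s y (hUW hyU)).mp hyU
    have h := hloc (W.2.primeIdealOf ⟨y, hUW hyU⟩).asIdeal hsy (Y.presheaf.stalk y)
    rw [Ideal.map_span, ← Set.range_comp] at h
    have hfun : (fun i => (Y.presheaf.germ (U : Y.Opens) y hyU).hom (u i)) =
        (algebraMap Γ(Y, W) (Y.presheaf.stalk y)) ∘ g := funext fun i => hres y hyU i
    rw [hfun]
    exact h
  have hcl : ∀ (y : Y) (hy : y ∈ (U : Y.Opens)),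
      (∀ i, (Y.presheaf.germ (U : Y.Opens) y hy).hom (u i) ∈ maximalIdeal (Y.presheaf.stalk y)) →
      y ∈ closure ({η} : Set Y) := by
    intro y hyU hyu
    letI algy : Algebra Γ(Y, W) (Y.presheaf.stalk y) :=
      TopCat.Presheaf.algebra_section_stalk Y.presheaf ⟨y, hUW hyU⟩
    haveI := W.2.isLocalization_stalk ⟨y, hUW hyU⟩
    refine mem_closure_of_primeIdealOf_le W hηW (hUW hyU) fun a ha => ?_
    have hle : Ideal.span (Set.range fun i => (Y.presheaf.germ (U : Y.Opens) y hyU).hom (u i)) ≤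
        maximalIdeal (Y.presheaf.stalk y) :=
      Ideal.span_le.mpr (Set.range_subset_iff.mpr hyu)
    rw [key y hyU] at hle
    have ha' := hle (Ideal.mem_map_of_mem _ ha)
    exact (IsLocalization.AtPrime.to_map_mem_maximal_iff (Y.presheaf.stalk y)
      (W.2.primeIdealOf ⟨y, hUW hyU⟩).asIdeal a).mp ha'
  refine ⟨U, hηU, u, hu, isWeightedChart_ofGermFiltration U u w (hηU := hηU) hw hxm hcl ?_ ?_ h0 hmul hprim⟩
  · -- regular stalks on `U ⊆ Ω`
    intro y hyU _
    exact (hWΩ (hUW hyU)).1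
  · -- independence in the cotangent space at the common zeros of `u`
    intro y hyU hyu
    have hyW : y ∈ (W : Y.Opens) := hUW hyU
    letI algy : Algebra Γ(Y, W) (Y.presheaf.stalk y) := TopCat.Presheaf.algebra_section_stalk Y.presheaf ⟨y, hyW⟩
    haveI := W.2.isLocalization_stalk ⟨y, hyW⟩
    haveI : IsRegularLocalRing (Y.presheaf.stalk y) := (hWΩ hyW).1
    have hyc : y ∈ closure ({η} : Set Y) := hcl y hyU hyu
    set z : Fin m → Y.presheaf.stalk y := fun i => (Y.presheaf.germ (U : Y.Opens) y hyU).hom (u i) with hz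
    -- `Q := (z) = 𝔭_η 𝒪_y` is a prime of height `m`
    have hQ : Ideal.span (Set.range z) = ((W.2.primeIdealOf ⟨η, hηW⟩).asIdeal).map
        (algebraMap Γ(Y, W) (Y.presheaf.stalk y)) := key y hyU
    have hle := primeIdealOf_le_of_mem_closure W hηW hyW hyc
    have hdisj : Disjoint ((W.2.primeIdealOf ⟨y, hyW⟩).asIdeal.primeCompl : Set Γ(Y, W))
        ((W.2.primeIdealOf ⟨η, hηW⟩).asIdeal : Set Γ(Y, W)) :=
      Set.disjoint_left.mpr fun a ha haη => ha (hle haη)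
    haveI hQprime : (Ideal.span (Set.range z)).IsPrime := by
      rw [hQ]
      exact IsLocalization.isPrime_of_isPrime_disjoint _ (Y.presheaf.stalk y) _ inferInstance hdisj
    have hQheight : (Ideal.span (Set.range z)).height = m := by
      rw [hQ, IsLocalization.height_map_of_disjoint (W.2.primeIdealOf ⟨y, hyW⟩).asIdeal.primeCompl _ hdisj]
      exact height_primeIdealOf_eq W hηW m hdim
    -- the quotient `𝒪_y ⧸ Q` is the (regular) local ring of the reduced `closure {η}` at `y`
    haveI : IsRegularLocalRing (Y.presheaf.stalk y ⧸ Ideal.span (Set.range z)) := by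
      have hyZ : y ∈ Set.range ι.base := by
        rw [Scheme.IdealSheafData.range_subschemeι, Scheme.IdealSheafData.coe_support_vanishingIdeal]
        exact hyc
      obtain ⟨y', hy'⟩ := hyZ
      have hreg' : IsRegularLocalRing ((vanishingIdeal Z).subscheme.presheaf.stalk y') := by
        by_contra hnot
        exact (hWΩ hyW).2 ⟨y', hnot, hy'⟩
      have h := isRegularLocalRing_quotient_map_primeIdealOf W hηW hyW y' hy' hreg'
      rw [hQ]
      exact h
    -- no `zᵢ` is redundant: Krull's height theorem
    have hmin : ∀ i, z i ∉ Ideal.span (z '' {j | j ≠ i}) := by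
      intro i hi
      have hS : ({j : Fin m | j ≠ i} : Set (Fin m)) = ↑(Finset.univ.erase i) := by
        ext j; simp
      rw [hS] at hi
      have heq : Ideal.span (Set.range z) = Ideal.span (z '' ↑(Finset.univ.erase i)) := by
        apply le_antisymm
        · refine Ideal.span_le.mpr (Set.range_subset_iff.mpr fun j => ?_)
          by_cases hji : j = i
          · subst hji; exact hi
          · exact Ideal.subset_span ⟨j, by simp [hji], rfl⟩
        · exact Ideal.span_mono (Set.image_subset_range _ _)
      have hmem : Ideal.span (Set.range z) ∈
          (Ideal.span (↑((Finset.univ.erase i).image z) : Set (Y.presheaf.stalk y))).minimalPrimes := by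
        rw [Finset.coe_image, ← heq, Ideal.minimalPrimes_eq_subsingleton_self]
        exact Set.mem_singleton _
      have hcard := Ideal.height_le_card_of_mem_minimalPrimes_span_finset hmem
      rw [hQheight] at hcard
      have hc : ((Finset.univ.erase i).image z).card ≤ m - 1 :=
        Finset.card_image_le.trans (by rw [Finset.card_erase_of_mem (Finset.mem_univ i), Finset.card_fin])
      have hm : 1 ≤ m := Nat.one_le_iff_ne_zero.mpr (fun h => by subst h; exact Fin.elim0 i)
      have h1 : (m : ℕ∞) ≤ ((m - 1 : ℕ) : ℕ∞) := hcard.trans (by exact_mod_cast hc)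
      have h2 : m ≤ m - 1 := by exact_mod_cast h1
      omega
    exact linearIndependent_toCotangent_of_isRegularLocalRing_quotient z hyu hmin

/-- **(o25-γ) in the shape of F-AQS-T's conclusion (items 1 and 4).**  Under the hypotheses of
`exists_isWeightedChart_ofGermFiltration`: an affine `U ∋ η`, sections `u` with germs `x`, the weighted chart
property of `R := ofGermFiltration η (x^α : w·α ≥ ·)` on `U`, AND `R.support = closure {η}`
(res-D-pv-025's `support_ofGermFiltration`). [cite: AbramovichQuekSchober2025, Thm 1.3 (1) with §4 (globalisation)] -/
theorem exists_isWeightedChart_and_support_ofGermFiltration {k : Type u} [Field k] {Y : Scheme.{u}}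
    (f : Y ⟶ Spec (.of k)) [LocallyOfFiniteType f] (η : Y) [IsRegularLocalRing (Y.presheaf.stalk η)] {m : ℕ}
    (hdim : ringKrullDim (Y.presheaf.stalk η) = (m : WithBot ℕ∞))
    (x : Fin m → Y.presheaf.stalk η) (hx : Ideal.span (Set.range x) = maximalIdeal (Y.presheaf.stalk η))
    (w : Fin m → ℕ) (hw : ∀ i, 0 < w i)
    (h0 : weightedMonomialIdeal x w 0 = ⊤)
    (hmul : ∀ a b, weightedMonomialIdeal x w a * weightedMonomialIdeal x w b ≤
      weightedMonomialIdeal x w (a + b))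
    (hprim : ∀ n, ∃ N : ℕ, maximalIdeal (Y.presheaf.stalk η) ^ N ≤ weightedMonomialIdeal x w n) :
    ∃ (U : Y.affineOpens) (hηU : η ∈ (U : Y.Opens)) (u : Fin m → Γ(Y, U)),
      (∀ i, (Y.presheaf.germ (U : Y.Opens) η hηU).hom (u i) = x i) ∧
      (ReesAlgebraData.ofGermFiltration η (fun n => weightedMonomialIdeal x w n) h0 hmul hprim).IsWeightedChart
        U u w ∧
      (ReesAlgebraData.ofGermFiltration η (fun n => weightedMonomialIdeal x w n) h0 hmul hprim).support =
        closure {η} := by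
  obtain ⟨U, hηU, u, hu, hchart⟩ :=
    exists_isWeightedChart_ofGermFiltration f η hdim x hx w hw h0 hmul hprim
  have hxm : ∀ i, x i ∈ maximalIdeal (Y.presheaf.stalk η) := fun i =>
    hx ▸ Ideal.subset_span (Set.mem_range_self i)
  refine ⟨U, hηU, u, hu, hchart, support_ofGermFiltration η _ h0 hmul hprim fun n hn => ?_⟩
  exact weightedMonomialIdeal_ne_top_of_le x w (maximalIdeal.isMaximal _).ne_top hxm hn

end Main

end Summit.ResolutionOfSingularities.ResolutionOfSingularities.Theorems.LexMaxCentreGlobal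

end
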